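import Literature.NumberTheory.Transcendental.RoySmallValueStep2Level
import Literature.NumberTheory.Transcendental.RoySmallValueDistance
import HarnessLib

/-!
# Roy's small value estimate for `𝔾ₐ × 𝔾ₘ` — Step 4: the sums over subsets of `𝒰` at the degree `D*`

Topic `Literature/NumberTheory/Transcendental`. Part of the formalisation of the proof of Roy 2013,
Theorem 1.1 (named fact `roy2013_thm_1_1`, `RoySmallValueEstimates.lean`). Source: D. Roy,
*A small value estimate for `𝔾ₐ × 𝔾ₘ`*, Mathematika 59 (2013) 333–363 = arXiv:1301.0663, §7,
Step 4 (p. 19 of the arXiv text):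

> [...] `Z` is not contained in the curve of `ℙ²` defined by the polynomial `P* := 𝒟^{i₀}P̃_{D*}`.
> [...] Proposition 2.4 gives `0 ≤ 7 log(3) D* deg(Z) + D* h(Z) + ∑_{α∈Z} log|P*(α)|`. Moreover
> [...] `max_{α∈Z} log|P*(α)| ≤ D* log(3) + log‖P*‖ ≤ 4(D*)^β`. Combining [...]
> `∑_{α∈Z} min{0, log|P*(α)|} ≥ −5(D*)^β deg(Z) − D* h(Z)`. [...] for a point `α ∈ 𝒰` [...]
> Proposition 4.2 provides the more precise estimate `|P*(α)| ≤ c₄ max|𝒟ⁱP*(1,γ)| + c₄^{D*}‖P*‖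
> (dist(α,(1:γ))^{T*} + dist(α,A_γ))` [...] thus `|P*(α)| ≥ 2c₄e^{−(D*)^ν/2}`, and so
> `log|P*(α)| ≤ 3(D*)^β + max{T* log dist(α,(1:γ)), log dist(α,A_γ)}` [...] for any subset `𝒮`
> of `𝒰`, `∑_{α∈𝒮} max{T* log dist(α,(1:γ)), log dist(α,A_γ)} ≥ −8(D*)^β deg(Z) − D* h(Z)`.

For an orbit `O` of normalised representatives (`ZeroConfigK`) and an INTEGER form `P*` of degree
`D*` non-vanishing on `O`, with `𝓛(P*) ≤ Λ` and `|𝒟ⁿP*(1,γ)| ≤ B` for `n < T*`, we prove the last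
display in the abstract form consumed by Step 5 (`step4_sums`): for every `𝒮 ⊆ 𝒰`,

  `−(D* H_O + #O log Λ + #𝒮 log(4 Λ c₄^{D*})) ≤ ∑_{j∈𝒮} max{T* log dist(α_j^u,(1:γ)), b_j}`

(`H_O = ∑_{j∈O} h_j`, `b_j` as in Step 2), provided `2 e^{2c₂²} B ≤ e^{−(D* H_O + #O log Λ)}` (the
"if `D*` is large enough" of the paper). Ingredients: Liouville on the orbit (`orbit_liouville_K`,
replacing Prop. 2.4), the crude bound `|P*(α^u)| ≤ 𝓛(P*)` (`norm_aeval_le_l1Norm`), Proposition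
4.2 (`prop_4_2`), and the tree's bookkeeping lemmas `sum_min_zero_ge`, `le_two_mul_of_le_add`,
`log_le_log_four_mul_add_max`, `sum_max_ge_of_pointwise` (seat B). Everything is proved; no
definitions, no named facts. Consumed by `RoySmallValueMainD` (`Setting.main_step`, Steps 3–5 at
a good degree) and, through it, by the proof of `roy2013_thm_1_1_holds` (`RoySmallValueMainE`).

## References

* [Roy2013] D. Roy, *A small value estimate for 𝔾ₐ × 𝔾ₘ*, Mathematika 59 (2013), 333–363
  (arXiv:1301.0663), §7, Step 4.
-/

noncomputable section

open MvPolynomial Finset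

namespace Literature.NumberTheory.Transcendental

namespace Roy2013

open Nesterenko

/-! ### The crude bound -/

/-- `|P(α)| ≤ 𝓛(P)` for `‖α‖_∞ ≤ 1`. [cite: Roy2013, §7, Step 4 ("`max log|P*(α)| ≤ … + log‖P*‖`")] -/
theorem norm_aeval_le_l1Norm {α : Fin 3 → ℂ} (hα : ∀ i, ‖α i‖ ≤ 1) (P : CX) :
    ‖aeval α P‖ ≤ l1Norm P := by
  classical
  conv_lhs => rw [P.as_sum]
  rw [map_sum, l1Norm]
  refine (norm_sum_le _ _).trans (Finset.sum_le_sum fun d _ => ?_)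
  have h1 : monomial d (coeff d P) = coeff d P • monomial d (1 : ℂ) := by
    rw [smul_monomial, smul_eq_mul, mul_one]
  rw [h1, map_smul, norm_smul]
  exact (mul_le_mul_of_nonneg_left (norm_aeval_monomial_one_le hα d) (norm_nonneg _)).trans
    (le_of_eq (mul_one _))

/-! ### The point estimate -/

/-- **The point estimate of Step 4**: if `x = |P*(α^u)|` satisfies Prop. 4.2's bound and
`x ≥ 2 e^{2c₂²} B`, then `log x ≤ log(4M) + max{T* log dist(α^u,(1:γ)), b}` where `M = Λ c₄^{D*}`
and `b = log dist(α^u, A_γ)` if this is non-zero (any `b` otherwise).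
[cite: Roy2013, §7, Step 4 ("thus `|P*(α)| ≥ 2c₄e^{−(D*)^ν/2}`, and so …")] -/
theorem log_le_of_prop_4_2 {x cB M p q b : ℝ} {Ts : ℕ} (hx : 0 < x) (hM : 0 < M) (hp : 0 < p)
    (hq : 0 ≤ q) (h : x ≤ cB + M * (p ^ Ts + q)) (h2 : 2 * cB ≤ x) (hb : q ≠ 0 → b = Real.log q) :
    Real.log x ≤ Real.log (4 * M) + max (Ts * Real.log p) b := by
  have h3 : x ≤ 2 * (M * (p ^ Ts + q)) := by linarith
  rcases eq_or_lt_of_le hq with hq0 | hqpos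
  · -- `q = 0`
    rw [← hq0, add_zero] at h3
    calc Real.log x ≤ Real.log (2 * (M * p ^ Ts)) := Real.log_le_log hx h3
      _ = Real.log 2 + Real.log M + Ts * Real.log p := by
          rw [Real.log_mul (by norm_num) (by positivity), Real.log_mul hM.ne' (by positivity),
            Real.log_pow]; ring
      _ ≤ Real.log (4 * M) + max (Ts * Real.log p) b := by
          rw [Real.log_mul (by norm_num) hM.ne']
          have : Real.log 2 ≤ Real.log 4 := Real.log_le_log (by norm_num) (by norm_num)
          linarith [le_max_left ((Ts : ℝ) * Real.log p) b]
  · rw [hb hqpos.ne']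
    exact log_le_log_four_mul_add_max hx hM hp hqpos h3

/-! ### The sums over subsets of `𝒰` -/

variable {K : IntermediateField ℚ ℂ} [Normal ℚ K] [NumberField K] {m : ℕ}

/-- **Roy 2013, Step 4 — the sums over subsets of `𝒰`.** See the module docstring.
[cite: Roy2013, §7, Step 4 (last display)] -/
theorem step4_sums (Z : ZeroConfigK K (Fin m)) {Ds Ts : ℕ} {ξ η : ℂ} (i₀ : Fin m)
    {Pz : MvPolynomial (Fin 3) ℤ} (hP : (map (Int.castRingHom ℂ) Pz).IsHomogeneous Ds)
    (hnz : ∀ j ∈ Z.orb i₀, eval (Z.α j) (map (Int.castRingHom ℂ) Pz) ≠ 0)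
    {Λ : ℝ} (hΛ1 : 1 ≤ Λ) (hΛ : l1Norm (map (Int.castRingHom ℂ) Pz) ≤ Λ)
    {B : ℝ} (hB0 : 0 ≤ B) (hB : ∀ n < Ts, ‖aeval ![1, ξ, η] (homD^[n] (map (Int.castRingHom ℂ) Pz))‖ ≤ B)
    (hsmall : 2 * (Real.exp (2 * roy_c2 ξ η ^ 2) * B) ≤
      Real.exp (-(Ds * ∑ j ∈ Z.orb i₀, hgtK Z j + (Z.orb i₀).card * Real.log Λ)))
    (hpd0 : ∀ j ∈ Z.orb i₀, 0 < pdist ξ η (unitRep (Z.α j)))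
    (b : Fin m → ℝ)
    (hb1 : ∀ j ∈ Z.orb i₀, pdist ξ η (unitRep (Z.α j)) ≤ (2 * roy_c2 ξ η)⁻¹ →
      adist ξ η (unitRep (Z.α j)) ≠ 0 → b j = Real.log (adist ξ η (unitRep (Z.α j))))
    {S : Finset (Fin m)}
    (hS : S ⊆ (Z.orb i₀).filter (fun j => pdist ξ η (unitRep (Z.α j)) ≤ (2 * roy_c2 ξ η)⁻¹)) :
    -((Ds : ℝ) * ∑ j ∈ Z.orb i₀, hgtK Z j + (Z.orb i₀).card * Real.log Λ +
        S.card * Real.log (4 * (Λ * roy_c4 ξ η ^ Ds))) ≤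
      ∑ j ∈ S, max (Ts * Real.log (pdist ξ η (unitRep (Z.α j)))) (b j) := by
  classical
  set O := Z.orb i₀ with hOdef
  set P : CX := map (Int.castRingHom ℂ) Pz with hPdef
  set x : Fin m → ℝ := fun j => Real.log ‖aeval (unitRep (Z.α j)) P‖ with hxdef
  have hαu : ∀ j, ∀ i, ‖unitRep (Z.α j) i‖ ≤ 1 := fun j => norm_unitRep_apply_le (Z.α_ne_zero j)
  have hαu1 : ∀ j, ∃ i, 1 ≤ ‖unitRep (Z.α j) i‖ := fun j => exists_one_le_norm_unitRep (Z.α_ne_zero j)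
  have hval : ∀ j, ‖aeval (unitRep (Z.α j)) P‖ = ‖eval (Z.α j) P‖ / ‖Z.α j‖ ^ Ds := fun j => by
    rw [norm_aeval_unitRep (Z.α_ne_zero j) hP]; rfl
  have hxpos : ∀ j ∈ O, 0 < ‖aeval (unitRep (Z.α j)) P‖ := fun j hj => by
    rw [hval]
    exact div_pos (norm_pos_iff.mpr (hnz j hj)) (pow_pos (norm_pos_iff.mpr (Z.α_ne_zero j)) _)
  -- Liouville on the orbit: `0 ≤ Ds H + ∑ x_j`
  have hL := orbit_liouville_K Z (isHomogeneous_int_of_map hP) i₀ hnz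
  have h0 : 0 ≤ (Ds : ℝ) * ∑ j ∈ O, hgtK Z j + ∑ j ∈ O, x j := by
    have h1 : ∑ j ∈ O, x j = ∑ j ∈ O, Real.log (‖eval (Z.α j) P‖ / ‖Z.α j‖ ^ Ds) :=
      Finset.sum_congr rfl fun j _ => by rw [hxdef]; simp only []; rw [hval]
    rw [h1]; linarith
  -- crude bound
  have hcrude : ∀ j ∈ O, x j ≤ Real.log Λ := fun j hj => by
    exact Real.log_le_log (hxpos j hj) ((norm_aeval_le_l1Norm (hαu j) P).trans hΛ)
  -- `∑ min{0, x_j} ≥ −(Ds H + #O log Λ)`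
  have hmin := sum_min_zero_ge O x (Real.log_nonneg hΛ1) h0 hcrude
  -- point estimate on `S`
  have hM : 0 < Λ * roy_c4 ξ η ^ Ds :=
    mul_pos (lt_of_lt_of_le one_pos hΛ1) (pow_pos (roy_c4_pos ξ η) _)
  have hpt : ∀ j ∈ S, x j - Real.log (4 * (Λ * roy_c4 ξ η ^ Ds)) ≤
      max (Ts * Real.log (pdist ξ η (unitRep (Z.α j)))) (b j) := by
    intro j hjS
    have hj' := hS hjS
    rw [mem_filter] at hj'
    obtain ⟨hj, hd⟩ := hj'
    -- Prop. 4.2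
    have h42 := prop_4_2 (T := Ts) hP (hαu j) (lemma_4_1 (hαu1 j) hd) hd hB0 hB
    -- lower bound `x_j ≥ −(Ds H + #O log Λ)`
    have hxlow : -((Ds : ℝ) * ∑ j ∈ O, hgtK Z j + O.card * Real.log Λ) ≤ x j := by
      have h1 : ∑ i ∈ O, min 0 (x i) ≤ min 0 (x j) := by
        rw [← Finset.sum_erase_add O (fun i => min 0 (x i)) hj]
        have : ∑ i ∈ O.erase j, min 0 (x i) ≤ 0 :=
          Finset.sum_nonpos fun i _ => min_le_left _ _
        linarith
      linarith [min_le_right (0 : ℝ) (x j)]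
    have h2x : 2 * (Real.exp (2 * roy_c2 ξ η ^ 2) * B) ≤ ‖aeval (unitRep (Z.α j)) P‖ := by
      refine hsmall.trans ?_
      rw [← Real.exp_log (hxpos j hj)]
      exact Real.exp_le_exp.mpr hxlow
    have hpd : 0 < pdist ξ η (unitRep (Z.α j)) := hpd0 j hj
    have hlemma := log_le_of_prop_4_2 (Ts := Ts) (hxpos j hj) hM hpd (adist_nonneg _ _ _)
      (by
        have := h42
        calc ‖aeval (unitRep (Z.α j)) P‖ ≤ Real.exp (2 * roy_c2 ξ η ^ 2) * B +
            l1Norm P * roy_c4 ξ η ^ Ds * (pdist ξ η (unitRep (Z.α j)) ^ Ts +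
              adist ξ η (unitRep (Z.α j))) := this
          _ ≤ Real.exp (2 * roy_c2 ξ η ^ 2) * B + Λ * roy_c4 ξ η ^ Ds *
            (pdist ξ η (unitRep (Z.α j)) ^ Ts + adist ξ η (unitRep (Z.α j))) := by
              have hpq : 0 ≤ pdist ξ η (unitRep (Z.α j)) ^ Ts + adist ξ η (unitRep (Z.α j)) :=
                add_nonneg (pow_nonneg (pdist_nonneg _ _ _) _) (adist_nonneg _ _ _)
              have := mul_le_mul_of_nonneg_right
                (mul_le_mul_of_nonneg_right hΛ (pow_nonneg (roy_c4_pos ξ η).le Ds)) hpq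
              linarith)
      h2x (hb1 j hj hd)
    rw [hxdef]
    linarith
  have hglue := sum_max_ge_of_pointwise (hS.trans (filter_subset _ _)) x
    (fun j => max (Ts * Real.log (pdist ξ η (unitRep (Z.α j)))) (b j)) hmin hpt
  linarith

end Roy2013

end Literature.NumberTheory.Transcendental
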